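import Mathlib.Analysis.Convex.SimplicialComplex.Basic
import Mathlib.Analysis.Convex.Combination
import Mathlib.Analysis.Convex.Join
import Mathlib.LinearAlgebra.AffineSpace.Independent
import Literature.Analysis.Convexity.ComplexTransport
import Literature.Analysis.Convexity.SignArrangement
import HarnessLib

/-!
# The standard extension of a subdivision (Munkres 7.11–7.12)

Let `K` be a finite geometric simplicial complex in a real vector space, `K₁` a subcomplex and
`R` a finite complex subdividing `K₁` simplexwise.  The **standard extension** of `R` to `K`
(Munkres, *Elementary differential topology* (1966), 7.11–7.12; Rourke–Sanderson (1972), 2.9) is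
a complex containing `R` and all simplices of `K` outside the closed star of `K₁` untouched,
obtained by coning, in order of increasing dimension, each remaining simplex from its centroid
over its (already subdivided) boundary.  This file proves it (`exists_standardExtension`).

Contents:
* barycentric weights `bw` of points of a closed simplex and their uniqueness/linearity
  (`eq_bw`, `bw_combo`, `bw_sum`), the relative interior `relInt` and relative boundary `relBd`;
* the **radial structure** of a closed simplex from its centroid: exit points
  (`exists_relBd_eq_combo`) and uniqueness of the radial representation (`radial_unique`);
  points moved towards the centroid are relatively interior (`combo_bary_mem_relInt`);
* **facets**: a convex subset of the closed simplex missing the relative interior lies in a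
  facet (`exists_subset_convexHull_erase`); hence cones `insert (bary u) r` over simplices in the
  boundary are simplices (`affineIndependent_insert_bary`);
* the **cone step** (`cone_step`): adjoining all cones over the current simplices inside a
  closed simplex whose relative interior is still free yields a simplicial complex, with the
  bookkeeping invariant `ConeInv` (every current simplex lies in a simplex of `K₁`, in a
  processed simplex, or is kept; every such simplex is covered simplexwise);
* the **iteration** over the simplices of the star of `K₁` in order of cardinality
  (`exists_initial`, `exists_cone_iterate`) and the final statement `exists_standardExtension`,
  including the vertex description `VertexDesc` (vertices are vertices of `R`, of kept
  simplices, or centroids of simplices of `K`).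

All definitions have bodies, everything is proved; no named facts are introduced.

## References

* J.R. Munkres, *Elementary differential topology*, Ann. of Math. Studies 54 (1963; rev. 1966),
  §7, Lemmas 7.11–7.12. [Munkres1966]
* C.P. Rourke, B.J. Sanderson, *Introduction to piecewise-linear topology*, Springer (1972), 2.9.
-/

open Set Function

noncomputable section

namespace Literature.Analysis.Convexity

variable {E : Type*} [AddCommGroup E] [Module ℝ E]


/-! ### Barycentric weights of points of a closed simplex -/

section Weights

/-- Barycentric weights of a point with respect to a finite configuration `u`: for
`x ∈ convexHull u` some nonnegative weights summing to `1` and representing `x` (unique when `u`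
is affinely independent); `0` otherwise. [folklore] -/
def bw (u : Finset E) (x : E) : E → ℝ := by
  classical
  exact if h : x ∈ convexHull ℝ (u : Set E) then Classical.choose (Finset.mem_convexHull'.1 h)
    else 0

variable {u : Finset E} {x : E}

/-- The defining properties of the barycentric weights. [folklore] -/
theorem bw_spec (hx : x ∈ convexHull ℝ (u : Set E)) :
    (∀ v ∈ u, 0 ≤ bw u x v) ∧ ∑ v ∈ u, bw u x v = 1 ∧ ∑ v ∈ u, bw u x v • v = x := by
  classical
  have h := Classical.choose_spec (Finset.mem_convexHull'.1 hx)
  simp only [bw, dif_pos hx]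
  exact h

/-- Nonnegativity of the weights. [folklore] -/
theorem bw_nonneg (hx : x ∈ convexHull ℝ (u : Set E)) {v : E} (hv : v ∈ u) : 0 ≤ bw u x v :=
  (bw_spec hx).1 v hv

/-- The weights sum to one. [folklore] -/
theorem sum_bw (hx : x ∈ convexHull ℝ (u : Set E)) : ∑ v ∈ u, bw u x v = 1 := (bw_spec hx).2.1

/-- The weights represent the point. [folklore] -/
theorem sum_bw_smul (hx : x ∈ convexHull ℝ (u : Set E)) : ∑ v ∈ u, bw u x v • v = x :=
  (bw_spec hx).2.2

/-- **Uniqueness of barycentric weights** for affinely independent `u`: any affine combination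
representing `x ∈ convexHull u` has the barycentric weights as coefficients. [folklore] -/
theorem eq_bw (hu : AffineIndependent ℝ ((↑) : u → E)) (hx : x ∈ convexHull ℝ (u : Set E))
    {w : E → ℝ} (hw1 : ∑ v ∈ u, w v = 1) (hwx : ∑ v ∈ u, w v • v = x) :
    ∀ v ∈ u, w v = bw u x v :=
  hu.eq_of_sum_eq_sum_subtype (hw1.trans (sum_bw hx).symm) (hwx.trans (sum_bw_smul hx).symm)

/-- The weights of a vertex. [folklore] -/
theorem bw_self [DecidableEq E] (hu : AffineIndependent ℝ ((↑) : u → E)) {v : E} (hv : v ∈ u)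
    {v' : E} (hv' : v' ∈ u) : bw u v v' = if v' = v then 1 else 0 := by
  classical
  have hx : v ∈ convexHull ℝ (u : Set E) := subset_convexHull ℝ _ hv
  symm
  refine eq_bw hu hx (w := fun v' => if v' = v then 1 else 0) ?_ ?_ v' hv'
  · rw [Finset.sum_ite_eq' u v, if_pos hv]
  · simp only [ite_smul, one_smul, zero_smul, Finset.sum_ite_eq', if_pos hv]

/-- Weights of a two-point combination. [folklore] -/
theorem bw_combo (hu : AffineIndependent ℝ ((↑) : u → E)) {x y : E}
    (hx : x ∈ convexHull ℝ (u : Set E)) (hy : y ∈ convexHull ℝ (u : Set E)) {a b : ℝ}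
    (ha : 0 ≤ a) (hb : 0 ≤ b) (hab : a + b = 1) {v : E} (hv : v ∈ u) :
    bw u (a • x + b • y) v = a * bw u x v + b * bw u y v := by
  have hz : a • x + b • y ∈ convexHull ℝ (u : Set E) := (convex_convexHull ℝ _) hx hy ha hb hab
  symm
  refine eq_bw hu hz (w := fun v => a * bw u x v + b * bw u y v) ?_ ?_ v hv
  · rw [Finset.sum_add_distrib, ← Finset.mul_sum, ← Finset.mul_sum, sum_bw hx, sum_bw hy,
      mul_one, mul_one, hab]
  · simp only [add_smul, mul_smul, Finset.sum_add_distrib, ← Finset.smul_sum, sum_bw_smul hx,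
      sum_bw_smul hy]

/-- The centroid has all weights `1 / #u`. [folklore] -/
theorem bw_bary (hu : AffineIndependent ℝ ((↑) : u → E)) (hne : u.Nonempty) {v : E} (hv : v ∈ u) :
    bw u (bary u) v = (u.card : ℝ)⁻¹ := by
  have hk : (0 : ℝ) < u.card := by exact_mod_cast hne.card_pos
  symm
  refine eq_bw hu (bary_mem_convexHull hne) (w := fun _ => (u.card : ℝ)⁻¹) ?_ rfl v hv
  rw [Finset.sum_const, nsmul_eq_mul, mul_inv_cancel₀ hk.ne']

/-- A point of the closed simplex with vanishing weight at `v` lies in the opposite facet.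
[folklore] -/
theorem mem_convexHull_erase_of_bw_eq_zero [DecidableEq E] (hx : x ∈ convexHull ℝ (u : Set E))
    {v : E} (hv0 : bw u x v = 0) : x ∈ convexHull ℝ (↑(u.erase v) : Set E) := by
  rw [← sum_bw_smul hx, ← Finset.sum_erase u (f := fun v' => bw u x v' • v') (by rw [hv0, zero_smul])]
  refine (convex_convexHull ℝ _).sum_mem (fun v' hv' => bw_nonneg hx (Finset.mem_of_mem_erase hv')) ?_
    fun v' hv' => subset_convexHull ℝ _ hv'
  rw [Finset.sum_erase u (f := fun v' => bw u x v') hv0, sum_bw hx]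

/-- Conversely, on the opposite facet the weight at `v` vanishes. [folklore] -/
theorem bw_eq_zero_of_mem_convexHull_erase [DecidableEq E] (hu : AffineIndependent ℝ ((↑) : u → E))
    {v : E} (hv : v ∈ u) (hx : x ∈ convexHull ℝ (↑(u.erase v) : Set E)) : bw u x v = 0 := by
  have hx' : x ∈ convexHull ℝ (u : Set E) := convexHull_mono (by simp) hx
  obtain ⟨w, -, hw1, hwx⟩ := Finset.mem_convexHull'.1 hx
  set w' : E → ℝ := fun v' => if v' = v then 0 else w v' with hw'
  have h1 : ∑ v' ∈ u, w' v' = 1 := by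
    rw [← Finset.sum_erase u (a := v) (by simp [hw'])]
    rw [← hw1]
    exact Finset.sum_congr rfl fun v' hv' => by simp [hw', Finset.ne_of_mem_erase hv']
  have h2 : ∑ v' ∈ u, w' v' • v' = x := by
    rw [← Finset.sum_erase u (a := v) (by simp [hw'])]
    rw [← hwx]
    exact Finset.sum_congr rfl fun v' hv' => by simp [hw', Finset.ne_of_mem_erase hv']
  have := eq_bw hu hx' h1 h2 v hv
  simp only [hw', if_pos rfl] at this
  exact this.symm

end Weights

/-! ### Relative interior and boundary of a closed simplex -/

section RelInt

variable {u : Finset E}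

/-- The relative interior of the closed simplex on `u`: points with all barycentric weights
positive. [folklore] -/
def relInt (u : Finset E) : Set E :=
  {x | x ∈ convexHull ℝ (u : Set E) ∧ ∀ v ∈ u, 0 < bw u x v}

/-- The relative boundary: points of the closed simplex with some vanishing weight. [folklore] -/
def relBd (u : Finset E) : Set E :=
  {x | x ∈ convexHull ℝ (u : Set E) ∧ ∃ v ∈ u, bw u x v = 0}

/-- The relative interior lies in the closed simplex. [folklore] -/
theorem relInt_subset_convexHull : relInt u ⊆ convexHull ℝ (u : Set E) := fun _ hx => hx.1

/-- The relative boundary lies in the closed simplex. [folklore] -/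
theorem relBd_subset_convexHull : relBd u ⊆ convexHull ℝ (u : Set E) := fun _ hx => hx.1

/-- A point of the closed simplex is either relatively interior or on the relative boundary.
[folklore] -/
theorem mem_relInt_or_mem_relBd {x : E} (hx : x ∈ convexHull ℝ (u : Set E)) :
    x ∈ relInt u ∨ x ∈ relBd u := by
  by_cases h : ∀ v ∈ u, 0 < bw u x v
  · exact Or.inl ⟨hx, h⟩
  · push Not at h
    obtain ⟨v, hv, hle⟩ := h
    exact Or.inr ⟨hx, v, hv, le_antisymm hle (bw_nonneg hx hv)⟩

/-- Relative interior and relative boundary are disjoint. [folklore] -/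
theorem not_mem_relBd_of_mem_relInt {x : E} (hx : x ∈ relInt u) : x ∉ relBd u := fun h => by
  obtain ⟨v, hv, h0⟩ := h.2
  exact (hx.2 v hv).ne' h0

/-- The centroid is relatively interior. [folklore] -/
theorem bary_mem_relInt (hu : AffineIndependent ℝ ((↑) : u → E)) (hne : u.Nonempty) :
    bary u ∈ relInt u :=
  ⟨bary_mem_convexHull hne, fun v hv => by
    rw [bw_bary hu hne hv]
    exact inv_pos.2 (by exact_mod_cast hne.card_pos)⟩

/-- **Relatively interior points lie in no proper subface.** [folklore] -/
theorem notMem_convexHull_of_mem_relInt [DecidableEq E] (hu : AffineIndependent ℝ ((↑) : u → E))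
    {x : E} (hx : x ∈ relInt u) {r : Finset E} (hr : r ⊂ u) :
    x ∉ convexHull ℝ (r : Set E) := fun hxr => by
  obtain ⟨v, hvu, hvr⟩ := Finset.exists_of_ssubset hr
  have hsub : (r : Set E) ⊆ ↑(u.erase v) := fun y hy =>
    Finset.mem_coe.2 (Finset.mem_erase.2 ⟨fun h => hvr (h ▸ hy), hr.1 hy⟩)
  have h0 := bw_eq_zero_of_mem_convexHull_erase hu hvu (convexHull_mono hsub hxr)
  exact (hx.2 v hvu).ne' h0

/-- **Moving towards the centroid enters the relative interior**: if `y` is in the closed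
simplex and `0 < μ ≤ 1` then `(1 - μ) • y + μ • bary u ∈ relInt u`. [folklore] -/
theorem combo_bary_mem_relInt (hu : AffineIndependent ℝ ((↑) : u → E)) {y : E}
    (hy : y ∈ convexHull ℝ (u : Set E)) {μ : ℝ} (hμ0 : 0 < μ) (hμ1 : μ ≤ 1) :
    (1 - μ) • y + μ • bary u ∈ relInt u := by
  have hne : u.Nonempty := by
    by_contra h
    rw [Finset.not_nonempty_iff_eq_empty] at h
    subst h
    simp at hy
  have hk : (0 : ℝ) < u.card := by exact_mod_cast hne.card_pos
  refine ⟨(convex_convexHull ℝ _) hy (bary_mem_convexHull hne) (by linarith) hμ0.le (by ring),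
    fun v hv => ?_⟩
  rw [bw_combo hu hy (bary_mem_convexHull hne) (by linarith) hμ0.le (by ring) hv, bw_bary hu hne hv]
  have := bw_nonneg hy hv
  have : 0 < μ * (u.card : ℝ)⁻¹ := mul_pos hμ0 (inv_pos.2 hk)
  nlinarith

end RelInt

/-! ### Radial structure of a closed simplex from its centroid -/

section Radial

variable {u : Finset E}

/-- **Exit point.** Every point `x ≠ bary u` of the closed simplex is `(1 - l) • y + l • bary u`
for a unique-to-be point `y` of the relative boundary and `0 ≤ l < 1`. [folklore] -/
theorem exists_relBd_eq_combo (hu : AffineIndependent ℝ ((↑) : u → E)) {x : E}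
    (hx : x ∈ convexHull ℝ (u : Set E)) (hxb : x ≠ bary u) :
    ∃ y ∈ relBd u, ∃ l : ℝ, 0 ≤ l ∧ l < 1 ∧ x = (1 - l) • y + l • bary u := by
  classical
  have hne : u.Nonempty := by
    by_contra h; rw [Finset.not_nonempty_iff_eq_empty] at h; subst h; simp at hx
  have hk : (0 : ℝ) < u.card := by exact_mod_cast hne.card_pos
  set w := bw u x with hw
  set a : ℝ := (u.card : ℝ)⁻¹ with ha
  have ha0 : 0 < a := inv_pos.2 hk
  -- some weight is `< a`
  set D : Finset E := u.filter fun v => w v < a with hD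
  have hDne : D.Nonempty := by
    by_contra hcon
    rw [Finset.not_nonempty_iff_eq_empty, hD, Finset.filter_eq_empty_iff] at hcon
    -- all weights `≥ a` and summing to `1 = ∑ a`: all equal `a`, so `x = bary u`
    have hall : ∀ v ∈ u, w v = a := by
      have hsum : ∑ v ∈ u, (w v - a) = 0 := by
        rw [Finset.sum_sub_distrib, sum_bw hx, Finset.sum_const, nsmul_eq_mul, ha,
          mul_inv_cancel₀ hk.ne', sub_self]
      have hnn : ∀ v ∈ u, 0 ≤ w v - a := fun v hv => sub_nonneg.2 (not_lt.1 (hcon hv))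
      intro v hv
      have := (Finset.sum_eq_zero_iff_of_nonneg hnn).1 hsum v hv
      linarith
    refine hxb ?_
    rw [← sum_bw_smul hx]
    exact Finset.sum_congr rfl fun v hv => by rw [show bw u x v = a from hall v hv]
  -- the exit parameter
  set T : ℝ := D.inf' hDne fun v => a / (a - w v) with hT
  obtain ⟨v₀, hv₀D, hTv₀⟩ := Finset.exists_mem_eq_inf' hDne fun v => a / (a - w v)
  have hTge : 1 ≤ T := by
    rw [hT, Finset.le_inf'_iff]
    intro v hv
    have hva : w v < a := (Finset.mem_filter.1 hv).2
    have hv0 : 0 ≤ w v := bw_nonneg hx (Finset.mem_filter.1 hv).1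
    rw [le_div_iff₀ (by linarith)]
    linarith
  have hT0 : 0 < T := by linarith
  have hTle : ∀ v ∈ D, T ≤ a / (a - w v) := fun v hv => Finset.inf'_le _ hv
  -- the exit point
  set c : E → ℝ := fun v => a + T * (w v - a) with hc
  have hc0 : ∀ v ∈ u, 0 ≤ c v := by
    intro v hv
    by_cases hva : w v < a
    · have h := hTle v (Finset.mem_filter.2 ⟨hv, hva⟩)
      rw [le_div_iff₀ (by linarith)] at h
      show 0 ≤ a + T * (w v - a)
      nlinarith
    · show 0 ≤ a + T * (w v - a)
      nlinarith [not_lt.1 hva]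
  have hc1 : ∑ v ∈ u, c v = 1 := by
    have hsw : ∑ v ∈ u, w v = 1 := sum_bw hx
    simp only [hc, Finset.sum_add_distrib, ← Finset.mul_sum, Finset.sum_sub_distrib, hsw,
      Finset.sum_const, nsmul_eq_mul, ha, mul_inv_cancel₀ hk.ne']
    ring
  have hcv₀ : c v₀ = 0 := by
    have hv₀a : w v₀ < a := (Finset.mem_filter.1 hv₀D).2
    show a + T * (w v₀ - a) = 0
    have hne0 : a - w v₀ ≠ 0 := (sub_pos.2 hv₀a).ne'
    rw [hT, hTv₀]
    field_simp
    ring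
  set y : E := ∑ v ∈ u, c v • v with hy
  have hyconv : y ∈ convexHull ℝ (u : Set E) :=
    (convex_convexHull ℝ _).sum_mem hc0 hc1 fun v hv => subset_convexHull ℝ _ hv
  have hybw : ∀ v ∈ u, c v = bw u y v := eq_bw hu hyconv hc1 rfl
  refine ⟨y, ⟨hyconv, v₀, (Finset.mem_filter.1 hv₀D).1, by rw [← hybw v₀ (Finset.mem_filter.1 hv₀D).1, hcv₀]⟩,
    1 - T⁻¹, ?_, ?_, ?_⟩
  · rw [sub_nonneg]; exact inv_le_one_of_one_le₀ hTge
  · have : 0 < T⁻¹ := inv_pos.2 hT0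
    linarith
  · -- `x = T⁻¹ • y + (1 - T⁻¹) • bary u`
    rw [sub_sub_cancel, hy, Finset.smul_sum, bary, Finset.smul_sum, ← Finset.sum_add_distrib,
      ← sum_bw_smul hx]
    refine Finset.sum_congr rfl fun v _ => ?_
    rw [smul_smul, smul_smul, ← add_smul]
    congr 1
    show bw u x v = T⁻¹ * (a + T * (bw u x v - a)) + (1 - T⁻¹) * (u.card : ℝ)⁻¹
    rw [← ha]
    field_simp
    ring

/-- **Radial uniqueness.** The representation `(1 - l) • y + l • bary u` with `y` on the relative
boundary and `0 ≤ l < 1` is unique. [folklore] -/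
theorem radial_unique (hu : AffineIndependent ℝ ((↑) : u → E)) {y y' : E} (hy : y ∈ relBd u)
    (hy' : y' ∈ relBd u) {l l' : ℝ} (hl0 : 0 ≤ l) (hl1 : l < 1) (hl0' : 0 ≤ l') (hl1' : l' < 1)
    (heq : (1 - l) • y + l • bary u = (1 - l') • y' + l' • bary u) : l = l' ∧ y = y' := by
  -- reduce to `l ≤ l'`
  suffices key : ∀ {y y' : E} {l l' : ℝ}, y ∈ relBd u → y' ∈ relBd u → 0 ≤ l → l < 1 → 0 ≤ l' →
      l' < 1 → (1 - l) • y + l • bary u = (1 - l') • y' + l' • bary u → l ≤ l' → l = l' ∧ y = y' by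
    rcases le_total l l' with h | h
    · exact key hy hy' hl0 hl1 hl0' hl1' heq h
    · obtain ⟨h1, h2⟩ := key hy' hy hl0' hl1' hl0 hl1 heq.symm h
      exact ⟨h1.symm, h2.symm⟩
  intro y y' l l' hy hy' hl0 hl1 hl0' hl1' heq hle
  -- `y = (1 - μ) • y' + μ • bary u` with `μ = (l' - l) / (1 - l)`
  set μ : ℝ := (l' - l) / (1 - l) with hμ
  have h1l : 0 < 1 - l := by linarith
  have hμ0 : 0 ≤ μ := div_nonneg (by linarith) h1l.le
  have hμ1 : μ < 1 := by rw [hμ, div_lt_one h1l]; linarith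
  have hyeq : y = (1 - μ) • y' + μ • bary u := by
    have h2 : (1 - l) • y = (1 - l') • y' + (l' - l) • bary u := by
      have := congrArg (fun z => z - l • bary u) heq
      simp only [add_sub_cancel_right] at this
      rw [this, add_sub_assoc, ← sub_smul]
    have h3 : y = (1 - l)⁻¹ • ((1 - l') • y' + (l' - l) • bary u) := by
      rw [← h2, smul_smul, inv_mul_cancel₀ h1l.ne', one_smul]
    have e1 : (1 - l)⁻¹ * (1 - l') = 1 - μ := by rw [hμ]; field_simp; ring
    have e2 : (1 - l)⁻¹ * (l' - l) = μ := by rw [hμ, inv_mul_eq_div]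
    rw [h3, smul_add, smul_smul, smul_smul, e1, e2]
  rcases hμ0.lt_or_eq with hμpos | hμ0'
  · exact (not_mem_relBd_of_mem_relInt (hyeq ▸ combo_bary_mem_relInt hu hy'.1 hμpos hμ1.le) hy).elim
  · have hll : l = l' := by
      have : l' - l = 0 := by
        rw [hμ, eq_comm, div_eq_zero_iff] at hμ0'
        exact hμ0'.resolve_right h1l.ne'
      linarith
    subst hll
    refine ⟨rfl, ?_⟩
    have h3 : (1 - l) • y = (1 - l) • y' := by
      have := congrArg (fun z => z - l • bary u) heq
      simpa using this
    exact smul_right_injective E h1l.ne' h3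

end Radial

/-! ### Convex subsets of the boundary; affine independence of cones -/

section Facet

variable {u : Finset E}

/-- Weights of a convex combination of points of the closed simplex are the corresponding
combination of weights. [folklore] -/
theorem bw_sum (hu : AffineIndependent ℝ ((↑) : u → E)) {ι : Type*} (I : Finset ι)
    {p : ι → E} (hp : ∀ i ∈ I, p i ∈ convexHull ℝ (u : Set E)) {μ : ι → ℝ}
    (hμ0 : ∀ i ∈ I, 0 ≤ μ i) (hμ1 : ∑ i ∈ I, μ i = 1) {v : E} (hv : v ∈ u) :
    bw u (∑ i ∈ I, μ i • p i) v = ∑ i ∈ I, μ i * bw u (p i) v := by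
  have hz : ∑ i ∈ I, μ i • p i ∈ convexHull ℝ (u : Set E) :=
    (convex_convexHull ℝ _).sum_mem hμ0 hμ1 hp
  symm
  refine eq_bw hu hz (w := fun v => ∑ i ∈ I, μ i * bw u (p i) v) ?_ ?_ v hv
  · rw [Finset.sum_comm]
    calc ∑ i ∈ I, ∑ v ∈ u, μ i * bw u (p i) v = ∑ i ∈ I, μ i := Finset.sum_congr rfl
          fun i hi => by rw [← Finset.mul_sum, sum_bw (hp i hi), mul_one]
      _ = 1 := hμ1
  · simp_rw [Finset.sum_smul, mul_smul]
    rw [Finset.sum_comm]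
    exact Finset.sum_congr rfl fun i hi => by rw [← Finset.smul_sum, sum_bw_smul (hp i hi)]

/-- **A convex subset of the closed simplex missing the relative interior lies in a facet.**
[folklore] -/
theorem exists_subset_convexHull_erase [DecidableEq E] (hu : AffineIndependent ℝ ((↑) : u → E))
    (hne : u.Nonempty) {S : Set E} (hS : Convex ℝ S) (hSu : S ⊆ convexHull ℝ (u : Set E))
    (hSint : ∀ x ∈ S, x ∉ relInt u) : ∃ v ∈ u, S ⊆ convexHull ℝ (↑(u.erase v) : Set E) := by
  by_contra hcon
  push Not at hcon
  -- for each vertex a point of `S` with positive weight there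
  have hpt : ∀ v ∈ u, ∃ p ∈ S, 0 < bw u p v := by
    intro v hv
    obtain ⟨p, hpS, hp⟩ := Set.not_subset.1 (hcon v hv)
    refine ⟨p, hpS, lt_of_le_of_ne (bw_nonneg (hSu hpS) hv) fun h0 => hp ?_⟩
    exact mem_convexHull_erase_of_bw_eq_zero (hSu hpS) h0.symm
  choose! p hpS hp using hpt
  have hk : (0 : ℝ) < u.card := by exact_mod_cast hne.card_pos
  -- their average lies in `S` and in the relative interior
  set z : E := ∑ v ∈ u, (u.card : ℝ)⁻¹ • p v with hz
  have hμ1 : ∑ _v ∈ u, (u.card : ℝ)⁻¹ = 1 := by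
    rw [Finset.sum_const, nsmul_eq_mul, mul_inv_cancel₀ hk.ne']
  have hzS : z ∈ S := hS.sum_mem (fun _ _ => by positivity) hμ1 hpS
  refine hSint z hzS ⟨hSu hzS, fun v hv => ?_⟩
  rw [hz, bw_sum hu u (fun v' hv' => hSu (hpS v' hv')) (fun _ _ => by positivity) hμ1 hv]
  refine lt_of_lt_of_le (mul_pos (inv_pos.2 hk) (hp v hv)) ?_
  exact Finset.single_le_sum (f := fun i => (u.card : ℝ)⁻¹ * bw u (p i) v)
    (fun i hi => mul_nonneg (inv_pos.2 hk).le (bw_nonneg (hSu (hpS i hi)) hv)) hv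

/-- A point of the affine span of a finite set is an affine combination of its points (weights
as a function on the ambient space). [folklore] -/
theorem exists_weights_of_mem_affineSpan {t : Finset E} {x : E}
    (hx : x ∈ affineSpan ℝ (t : Set E)) :
    ∃ W : E → ℝ, ∑ y ∈ t, W y = 1 ∧ ∑ y ∈ t, W y • y = x := by
  classical
  have hx' : x ∈ affineSpan ℝ (Set.range ((↑) : t → E)) := by rwa [Subtype.range_coe]
  obtain ⟨w, hw1, hwx⟩ := eq_affineCombination_of_mem_affineSpan_of_fintype hx'
  rw [Finset.affineCombination_eq_linear_combination _ _ _ hw1] at hwx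
  set W : E → ℝ := fun y => if h : y ∈ t then w ⟨y, h⟩ else 0 with hW
  have hWw : ∀ i : t, W i = w i := fun i => by simp only [hW, dif_pos i.2]
  refine ⟨W, ?_, ?_⟩
  · rw [← Finset.sum_coe_sort]; simp_rw [hWw]; exact hw1
  · rw [← Finset.sum_coe_sort]; simp_rw [hWw]; exact hwx.symm

/-- The centroid is not an affine combination of the points of a proper facet. [folklore] -/
theorem bary_notMem_affineSpan_erase [DecidableEq E] (hu : AffineIndependent ℝ ((↑) : u → E))
    {v : E} (hv : v ∈ u) : bary u ∉ affineSpan ℝ (↑(u.erase v) : Set E) := by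
  intro hmem
  obtain ⟨W, hW1, hWb⟩ := exists_weights_of_mem_affineSpan hmem
  have hne : u.Nonempty := ⟨v, hv⟩
  set W' : E → ℝ := fun y => if y = v then 0 else W y with hW'
  have h1 : ∑ y ∈ u, W' y = 1 := by
    rw [← Finset.sum_erase u (a := v) (by simp [hW']), ← hW1]
    exact Finset.sum_congr rfl fun y hy => by simp [hW', Finset.ne_of_mem_erase hy]
  have h2 : ∑ y ∈ u, W' y • y = bary u := by
    rw [← Finset.sum_erase u (a := v) (by simp [hW']), ← hWb]
    exact Finset.sum_congr rfl fun y hy => by simp [hW', Finset.ne_of_mem_erase hy]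
  have := eq_bw hu (bary_mem_convexHull hne) h1 h2 v hv
  rw [bw_bary hu hne hv] at this
  simp only [hW', if_pos rfl] at this
  exact (inv_pos.2 (show (0 : ℝ) < u.card by exact_mod_cast hne.card_pos)).ne this

/-- **Cones are simplices.** If `r` is affinely independent with `convexHull r` inside a
proper facet of the simplex on `u`, then `insert (bary u) r` is affinely independent.
[folklore] -/
theorem affineIndependent_insert_bary [DecidableEq E] (hu : AffineIndependent ℝ ((↑) : u → E))
    {v : E} (hv : v ∈ u) {r : Finset E} (hr : AffineIndependent ℝ ((↑) : r → E))
    (hru : (r : Set E) ⊆ convexHull ℝ (↑(u.erase v) : Set E)) :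
    AffineIndependent ℝ ((↑) : ↥(insert (bary u) r : Finset E) → E) := by
  have hnot : bary u ∉ affineSpan ℝ (r : Set E) := fun h =>
    bary_notMem_affineSpan_erase hu hv ((affineSpan_mono ℝ hru).trans
      (affineSpan_le.2 (convexHull_subset_affineSpan _)) h)
  have h := SignArrangement.affineIndependent_insert_of_notMem hr hnot
  rw [← Finset.coe_insert] at h
  exact h

end Facet

/-! ### Cones over the subdivided boundary of a simplex -/

section Cone

variable [DecidableEq E] {u : Finset E}

/-- Points of the cone `convexHull (insert b r)`. [folklore] -/
theorem mem_convexHull_insert_iff' {b : E} {r : Finset E} (hr : r.Nonempty) {z : E} :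
    z ∈ convexHull ℝ (↑(insert b r) : Set E) ↔
      ∃ y ∈ convexHull ℝ (r : Set E), ∃ l : ℝ, 0 ≤ l ∧ l ≤ 1 ∧ z = (1 - l) • y + l • b := by
  rw [Finset.coe_insert, convexHull_insert (Finset.coe_nonempty.2 hr), mem_convexJoin]
  simp only [Set.mem_singleton_iff, exists_eq_left]
  constructor
  · rintro ⟨y, hy, hz⟩
    rw [segment_symm, segment_eq_image] at hz
    obtain ⟨l, ⟨hl0, hl1⟩, rfl⟩ := hz
    exact ⟨y, hy, l, hl0, hl1, rfl⟩
  · rintro ⟨y, hy, l, hl0, hl1, rfl⟩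
    refine ⟨y, hy, ?_⟩
    rw [segment_symm, segment_eq_image]
    exact ⟨l, ⟨hl0, hl1⟩, rfl⟩

/-- The cone over a subset of the closed simplex from the centroid lies in the closed simplex.
[folklore] -/
theorem convexHull_insert_bary_subset {r : Finset E} (hr : r.Nonempty)
    (hru : convexHull ℝ (r : Set E) ⊆ convexHull ℝ (u : Set E)) (hune : u.Nonempty) :
    convexHull ℝ (↑(insert (bary u) r) : Set E) ⊆ convexHull ℝ (u : Set E) := by
  intro z hz
  obtain ⟨y, hy, l, hl0, hl1, rfl⟩ := (mem_convexHull_insert_iff' hr).1 hz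
  exact (convex_convexHull ℝ _) (hru hy) (bary_mem_convexHull hune) (by linarith) hl0 (by ring)

variable (K : Geometry.SimplicialComplex ℝ E) (K₁ : Set (Finset E)) (C : Geometry.SimplicialComplex ℝ E)
  (Done : Set (Finset E))

/-- The simplices of `K` outside the closed star of `K₁`: not in `K₁` and with no vertex in a
simplex of `K₁`. They are never subdivided. [folklore] -/
def Kept : Set (Finset E) := {τ | τ ∈ K.faces ∧ τ ∉ K₁ ∧ ∀ s ∈ K₁, τ ∩ s = ∅}

/-- The invariant of the cone construction after processing the simplices in `Done`: every simplex
of the current complex `C` lies in a simplex of `K₁`, or in a processed simplex, or is kept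
(`refines`); and every simplex of `K₁`, every processed simplex and every kept simplex is covered
simplexwise by `C` (`covers`). (A `Prop`-valued structure: bookkeeping, not a named fact.)
[folklore] -/
structure ConeInv : Prop where
  /-- every current simplex lies in a simplex of `K₁`, in a processed simplex, or is kept -/
  refines : ∀ r ∈ C.faces, (∃ s ∈ K₁, convexHull ℝ (r : Set E) ⊆ convexHull ℝ (s : Set E)) ∨
    (∃ u ∈ Done, convexHull ℝ (r : Set E) ⊆ convexHull ℝ (u : Set E)) ∨ r ∈ Kept K K₁
  /-- every simplex of `K₁`, processed or kept simplex is covered simplexwise -/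
  covers : ∀ s, (s ∈ K₁ ∨ s ∈ Done ∨ s ∈ Kept K K₁) → ∀ y ∈ convexHull ℝ (s : Set E),
    ∃ r ∈ C.faces, y ∈ convexHull ℝ (r : Set E) ∧ convexHull ℝ (r : Set E) ⊆ convexHull ℝ (s : Set E)

variable {K K₁ C Done}

/-- **Unprocessed simplices have free relative interior.** Under the invariant, if `u ∈ K` is
neither in `K₁`, nor processed, nor kept, and all processed simplices have at most `#u` vertices,
then no simplex of `C` meets the relative interior of `u`. [folklore] -/
theorem relInt_disjoint_of_coneInv (hK₁ : K₁ ⊆ K.faces)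
    (hdown : ∀ s ∈ K₁, ∀ t ⊆ s, t.Nonempty → t ∈ K₁) (hDone : Done ⊆ K.faces)
    (hinv : ConeInv K K₁ C Done) {u : Finset E} (hu : u ∈ K.faces) (hu₁ : u ∉ K₁) (huD : u ∉ Done)
    (huK : u ∉ Kept K K₁) (hcard : ∀ u'' ∈ Done, u''.card ≤ u.card) {x : E} (hx : x ∈ relInt u)
    (hxC : x ∈ C.space) : False := by
  obtain ⟨r, hr, hxr⟩ := Geometry.SimplicialComplex.mem_space_iff.1 hxC
  -- `x` lies in a simplex `s'` of `K` containing `conv r`; then `u ⊆ s'`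
  have key : ∀ s' ∈ K.faces, x ∈ convexHull ℝ (s' : Set E) → u ⊆ s' := by
    intro s' hs' hxs'
    have hxi : x ∈ convexHull ℝ (↑(u ∩ s') : Set E) := by
      rw [Finset.coe_inter]
      exact K.inter_subset_convexHull hu hs' ⟨hx.1, hxs'⟩
    by_contra hnot
    have hss : u ∩ s' ⊂ u := Finset.ssubset_iff_subset_ne.2 ⟨Finset.inter_subset_left, fun heq =>
      hnot (heq ▸ Finset.inter_subset_right)⟩
    exact notMem_convexHull_of_mem_relInt (K.indep hu) hx hss hxi
  rcases hinv.refines r hr with ⟨s, hs, hrs⟩ | ⟨u'', hu'', hru''⟩ | hkept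
  · have hus : u ⊆ s := key s (hK₁ hs) (hrs hxr)
    exact hu₁ (hdown s hs u hus (K.nonempty_of_mem_faces hu))
  · have hus : u ⊆ u'' := key u'' (hDone hu'') (hru'' hxr)
    have : u = u'' := Finset.eq_of_subset_of_card_le hus (hcard u'' hu'')
    exact huD (this ▸ hu'')
  · have hus : u ⊆ r := key r hkept.1 hxr
    -- `u ⊆ r` with `r` kept: then `u` is kept as well
    refine huK ⟨hu, hu₁, fun s hs => ?_⟩
    have := hkept.2.2 s hs
    rw [← Finset.subset_empty, ← this]
    exact Finset.inter_subset_inter hus (Finset.Subset.refl s)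

/-- Points of a cone face `insert (bary u) r` (`r` a simplex with hull in the closed simplex, or
empty): the apex, or a point `(1 - l) • y + l • bary u` with `y ∈ convexHull r` and `0 ≤ l < 1`.
[folklore] -/
theorem eq_bary_or_exists_of_mem_convexHull_insert {r : Finset E} {z : E}
    (hz : z ∈ convexHull ℝ (↑(insert (bary u) r) : Set E)) :
    z = bary u ∨ ∃ y ∈ convexHull ℝ (r : Set E), ∃ l : ℝ, 0 ≤ l ∧ l < 1 ∧
      z = (1 - l) • y + l • bary u := by
  rcases r.eq_empty_or_nonempty with rfl | hr
  · left
    simpa using hz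
  · obtain ⟨y, hy, l, hl0, hl1, rfl⟩ := (mem_convexHull_insert_iff' hr).1 hz
    rcases hl1.lt_or_eq with hl1 | rfl
    · exact Or.inr ⟨y, hy, l, hl0, hl1, rfl⟩
    · left; simp

/-- **The cone step of the standard extension** (Munkres (1966), 7.11). Let the invariant hold
for `C` and the processed set `Done`, and let `u ∈ K` be an unprocessed simplex of the star of
`K₁` all of whose proper faces are in `K₁`, processed or kept, with `#u'' ≤ #u` for processed
`u''`. Then adjoining the cones `insert (bary u) r` over the simplices `r` of `C` inside the
closed simplex of `u` (and the apex) yields a simplicial complex satisfying the invariant for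
`insert u Done`. [cite: Munkres1966, Lemma 7.11] -/
theorem cone_step (hK₁ : K₁ ⊆ K.faces) (hdown : ∀ s ∈ K₁, ∀ t ⊆ s, t.Nonempty → t ∈ K₁)
    (hDone : Done ⊆ K.faces) (hCfin : C.faces.Finite) (hinv : ConeInv K K₁ C Done)
    {u : Finset E} (hu : u ∈ K.faces) (hu₁ : u ∉ K₁) (huD : u ∉ Done) (huK : u ∉ Kept K K₁)
    (hfaces : ∀ u' ∈ K.faces, u' ⊂ u → u' ∈ K₁ ∨ u' ∈ Done ∨ u' ∈ Kept K K₁)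
    (hcard : ∀ u'' ∈ Done, u''.card ≤ u.card) :
    ∃ C' : Geometry.SimplicialComplex ℝ E, C'.faces.Finite ∧ C.faces ⊆ C'.faces ∧
      ConeInv K K₁ C' (insert u Done) ∧
      ∀ t ∈ C'.faces, t ∈ C.faces ∨ ∃ r, (r ∈ C.faces ∨ r = ∅) ∧ t = insert (bary u) r := by
  classical
  set b : E := bary u with hb
  have hune : u.Nonempty := K.nonempty_of_mem_faces hu
  have huind : AffineIndependent ℝ ((↑) : u → E) := K.indep hu
  have hbri : b ∈ relInt u := bary_mem_relInt huind hune
  have hbu : b ∈ convexHull ℝ (u : Set E) := hbri.1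
  -- free relative interior
  have hfree : ∀ x ∈ relInt u, x ∉ C.space := fun x hx hxC =>
    relInt_disjoint_of_coneInv hK₁ hdown hDone hinv hu hu₁ huD huK hcard hx hxC
  have hbC : b ∉ C.space := hfree b hbri
  have hbr : ∀ r ∈ C.faces, b ∉ r := fun r hr hbr => hbC (C.subset_space hr hbr)
  -- simplices of `C` inside the closed simplex lie in facets
  have hfacet : ∀ r ∈ C.faces, convexHull ℝ (r : Set E) ⊆ convexHull ℝ (u : Set E) →
      ∃ v ∈ u, convexHull ℝ (r : Set E) ⊆ convexHull ℝ (↑(u.erase v) : Set E) := fun r hr hru =>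
    exists_subset_convexHull_erase huind hune (convex_convexHull ℝ _) hru fun x hx hxi =>
      hfree x hxi (C.convexHull_subset_space hr hx)
  -- points of `C` in the closed simplex are on the relative boundary
  have hbd : ∀ r ∈ C.faces, convexHull ℝ (r : Set E) ⊆ convexHull ℝ (u : Set E) →
      ∀ y ∈ convexHull ℝ (r : Set E), y ∈ relBd u := fun r hr hru y hy =>
    (mem_relInt_or_mem_relBd (hru hy)).resolve_left fun h => hfree y h (C.convexHull_subset_space hr hy)
  -- the new faces
  set N : Set (Finset E) := {t | ∃ r, (r ∈ C.faces ∧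
    convexHull ℝ (r : Set E) ⊆ convexHull ℝ (u : Set E) ∨ r = ∅) ∧ t = insert b r} with hN
  -- hulls of new faces lie in the closed simplex
  have hNsub : ∀ r, (r ∈ C.faces ∧ convexHull ℝ (r : Set E) ⊆ convexHull ℝ (u : Set E) ∨ r = ∅) →
      convexHull ℝ (↑(insert b r) : Set E) ⊆ convexHull ℝ (u : Set E) := by
    rintro r (⟨hr, hru⟩ | rfl)
    · exact convexHull_insert_bary_subset (C.nonempty_of_mem_faces hr) hru hune
    · simpa using hbu
  -- intersections: cone with old
  have hco : ∀ r, (r ∈ C.faces ∧ convexHull ℝ (r : Set E) ⊆ convexHull ℝ (u : Set E) ∨ r = ∅) →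
      ∀ r' ∈ C.faces, convexHull ℝ (↑(insert b r) : Set E) ∩ convexHull ℝ (r' : Set E) ⊆
        convexHull ℝ (↑(insert b r ∩ r') : Set E) := by
    intro r hr r' hr' z ⟨hz, hz'⟩
    have hzC : z ∈ C.space := C.convexHull_subset_space hr' hz'
    rcases eq_bary_or_exists_of_mem_convexHull_insert hz with rfl | ⟨y, hy, l, hl0, hl1, rfl⟩
    · exact (hbC hzC).elim
    · rcases hr with ⟨hr, hru⟩ | rfl
      · rcases hl0.lt_or_eq with hlpos | rfl
        · exact (hfree _ (combo_bary_mem_relInt huind (hru hy) hlpos hl1.le) hzC).elim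
        · simp only [sub_zero, one_smul, zero_smul, add_zero] at hz' ⊢
          have h := C.inter_subset_convexHull hr hr' ⟨hy, hz'⟩
          refine convexHull_mono ?_ h
          intro v hv
          simp only [Finset.coe_inter, Set.mem_inter_iff, Finset.mem_coe, Finset.mem_insert] at hv ⊢
          exact ⟨Or.inr hv.1, hv.2⟩
      · simp at hy
  -- intersections: cone with cone
  have hcc : ∀ r₁, (r₁ ∈ C.faces ∧ convexHull ℝ (r₁ : Set E) ⊆ convexHull ℝ (u : Set E) ∨ r₁ = ∅) →
      ∀ r₂, (r₂ ∈ C.faces ∧ convexHull ℝ (r₂ : Set E) ⊆ convexHull ℝ (u : Set E) ∨ r₂ = ∅) →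
      convexHull ℝ (↑(insert b r₁) : Set E) ∩ convexHull ℝ (↑(insert b r₂) : Set E) ⊆
        convexHull ℝ (↑(insert b r₁ ∩ insert b r₂) : Set E) := by
    intro r₁ hr₁ r₂ hr₂ z ⟨hz₁, hz₂⟩
    rw [← Finset.insert_inter_distrib]
    have hbmem : b ∈ convexHull ℝ (↑(insert b (r₁ ∩ r₂)) : Set E) :=
      subset_convexHull ℝ _ (Finset.mem_coe.2 (Finset.mem_insert_self _ _))
    rcases eq_bary_or_exists_of_mem_convexHull_insert hz₁ with rfl | ⟨y₁, hy₁, l₁, hl₁0, hl₁1, rfl⟩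
    · exact hbmem
    rcases eq_bary_or_exists_of_mem_convexHull_insert hz₂ with hzb | ⟨y₂, hy₂, l₂, hl₂0, hl₂1, hz⟩
    · rw [hzb]; exact hbmem
    -- both cones have nonempty base
    rcases hr₁ with ⟨hr₁, hr₁u⟩ | rfl
    swap; · simp at hy₁
    rcases hr₂ with ⟨hr₂, hr₂u⟩ | rfl
    swap; · simp at hy₂
    obtain ⟨hl, hy⟩ := radial_unique huind (hbd r₁ hr₁ hr₁u y₁ hy₁) (hbd r₂ hr₂ hr₂u y₂ hy₂)
      hl₁0 hl₁1 hl₂0 hl₂1 hz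
    have hy₁₂ : y₁ ∈ convexHull ℝ (↑(r₁ ∩ r₂) : Set E) := by
      rw [Finset.coe_inter]
      exact C.inter_subset_convexHull hr₁ hr₂ ⟨hy₁, hy ▸ hy₂⟩
    have hy' : y₁ ∈ convexHull ℝ (↑(insert b (r₁ ∩ r₂)) : Set E) :=
      convexHull_mono (by rw [Finset.coe_insert]; exact Set.subset_insert _ _) hy₁₂
    exact (convex_convexHull ℝ _) hy' hbmem (by linarith) hl₁0 (by ring)
  -- the new complex
  let C' : Geometry.SimplicialComplex ℝ E :=
    { faces := C.faces ∪ N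
      isRelLowerSet_faces := by
        rintro t (ht | ⟨r, hr, rfl⟩)
        · obtain ⟨hne, hlow⟩ := C.isRelLowerSet_faces ht
          exact ⟨hne, fun t' ht' hne' => Or.inl (hlow ht' hne')⟩
        · refine ⟨Finset.insert_nonempty _ _, fun t' ht' hne' => ?_⟩
          by_cases hbt : b ∈ t'
          · -- `t' = insert b (t'.erase b)` is a cone face
            right
            refine ⟨t'.erase b, ?_, (Finset.insert_erase hbt).symm⟩
            have hsub : t'.erase b ⊆ r := fun v hv => by
              have hv' := ht' (Finset.mem_of_mem_erase hv)
              exact (Finset.mem_insert.1 hv').resolve_left (Finset.ne_of_mem_erase hv)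
            rcases (t'.erase b).eq_empty_or_nonempty with h0 | hne0
            · exact Or.inr h0
            · rcases hr with ⟨hr, hru⟩ | rfl
              · exact Or.inl ⟨C.down_closed hr hsub hne0, (convexHull_mono (by exact_mod_cast hsub)).trans hru⟩
              · exact (Finset.not_nonempty_empty (Finset.subset_empty.1 hsub ▸ hne0)).elim
          · -- `t' ⊆ r` is an old face
            left
            have hsub : t' ⊆ r := fun v hv =>
              (Finset.mem_insert.1 (ht' hv)).resolve_left fun h => hbt (h ▸ hv)
            rcases hr with ⟨hr, -⟩ | rfl
            · exact C.down_closed hr hsub hne'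
            · exact (Finset.not_nonempty_empty (Finset.subset_empty.1 hsub ▸ hne')).elim
      indep := by
        rintro t (ht | ⟨r, hr, rfl⟩)
        · exact C.indep ht
        · rcases hr with ⟨hr, hru⟩ | rfl
          · obtain ⟨v, hv, hrv⟩ := hfacet r hr hru
            exact affineIndependent_insert_bary huind hv (C.indep hr)
              ((subset_convexHull ℝ _).trans hrv)
          · rw [Finset.insert_empty]
            haveI : Subsingleton (↥({b} : Finset E)) :=
              ⟨fun x y => Subtype.ext ((Finset.mem_singleton.1 x.2).trans (Finset.mem_singleton.1 y.2).symm)⟩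
            exact affineIndependent_of_subsingleton ℝ _
      inter_subset_convexHull := by
        rintro t t' (ht | ⟨r, hr, rfl⟩) (ht' | ⟨r', hr', rfl⟩)
        · exact C.inter_subset_convexHull ht ht'
        · have h := hco r' hr' t ht
          rw [Finset.inter_comm] at h
          rw [Set.inter_comm]
          simpa only [Finset.coe_inter] using h
        · simpa only [Finset.coe_inter] using hco r hr t' ht'
        · simpa only [Finset.coe_inter] using hcc r hr r' hr' }
  refine ⟨C', ?_, fun t ht => Or.inl ht, ⟨?_, ?_⟩, ?_⟩
  · -- finiteness
    have hNfin : N.Finite := by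
      refine ((hCfin.toFinset.image fun r => insert b r).finite_toSet.union (Set.finite_singleton {b})).subset ?_
      rintro _ ⟨r, hr, rfl⟩
      rcases hr with ⟨hr, -⟩ | rfl
      · exact Or.inl (Finset.mem_coe.2 (Finset.mem_image.2 ⟨r, hCfin.mem_toFinset.2 hr, rfl⟩))
      · exact Or.inr (by simp)
    exact hCfin.union hNfin
  · -- invariant, part 1
    rintro r (hr | ⟨r₀, hr₀, rfl⟩)
    · rcases hinv.refines r hr with h | ⟨u'', hu'', h⟩ | h
      · exact Or.inl h
      · exact Or.inr (Or.inl ⟨u'', Set.mem_insert_of_mem _ hu'', h⟩)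
      · exact Or.inr (Or.inr h)
    · exact Or.inr (Or.inl ⟨u, Set.mem_insert _ _, hNsub r₀ hr₀⟩)
  · -- invariant, part 2
    intro s hs y hy
    have hold : ∀ s, (s ∈ K₁ ∨ s ∈ Done ∨ s ∈ Kept K K₁) → ∀ y ∈ convexHull ℝ (s : Set E),
        ∃ r ∈ C'.faces, y ∈ convexHull ℝ (r : Set E) ∧
          convexHull ℝ (r : Set E) ⊆ convexHull ℝ (s : Set E) := fun s hs y hy => by
      obtain ⟨r, hr, hyr, hrs⟩ := hinv.covers s hs y hy
      exact ⟨r, Or.inl hr, hyr, hrs⟩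
    rcases hs with hs | hs | hs
    · exact hold s (Or.inl hs) y hy
    · rcases Set.mem_insert_iff.1 hs with hsu | hs
      · -- the new simplex `u`
        rw [hsu] at hy ⊢
        by_cases hyb : y = b
        · refine ⟨{b}, Or.inr ⟨∅, Or.inr rfl, by simp⟩, by simp [hyb], by simpa using hbu⟩
        · obtain ⟨y₀, hy₀, l, hl0, hl1, rfl⟩ := exists_relBd_eq_combo huind hy hyb
          obtain ⟨v, hv, hv0⟩ := hy₀.2
          have hy₀v := mem_convexHull_erase_of_bw_eq_zero hy₀.1 hv0
          have hne : (u.erase v).Nonempty := by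
            by_contra h0
            rw [Finset.not_nonempty_iff_eq_empty] at h0
            rw [h0] at hy₀v
            simp at hy₀v
          have hface : u.erase v ∈ K.faces := K.down_closed hu (Finset.erase_subset v u) hne
          have hss : u.erase v ⊂ u := Finset.erase_ssubset hv
          obtain ⟨r₀, hr₀, hy₀r₀, hr₀s⟩ := hinv.covers (u.erase v) (hfaces _ hface hss) y₀ hy₀v
          have hr₀u : convexHull ℝ (r₀ : Set E) ⊆ convexHull ℝ (u : Set E) :=
            hr₀s.trans (convexHull_mono (by simp))
          refine ⟨insert b r₀, Or.inr ⟨r₀, Or.inl ⟨hr₀, hr₀u⟩, rfl⟩, ?_, hNsub r₀ (Or.inl ⟨hr₀, hr₀u⟩)⟩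
          exact (mem_convexHull_insert_iff' (C.nonempty_of_mem_faces hr₀)).2 ⟨y₀, hy₀r₀, l, hl0, hl1.le, rfl⟩
      · exact hold s (Or.inr (Or.inl hs)) y hy
    · exact hold s (Or.inr (Or.inr hs)) y hy
  · -- description of the faces
    rintro t (ht | ⟨r, hr, rfl⟩)
    · exact Or.inl ht
    · refine Or.inr ⟨r, ?_, rfl⟩
      rcases hr with ⟨hr, -⟩ | h
      · exact Or.inl hr
      · exact Or.inr h

end Cone



/-! ### The standard extension -/

section Extension

variable [DecidableEq E] {K : Geometry.SimplicialComplex ℝ E} {K₁ : Set (Finset E)}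
  {R : Geometry.SimplicialComplex ℝ E}

/-- The simplices to be coned: those of `K` neither in `K₁` nor kept. [folklore] -/
def ToCone (K : Geometry.SimplicialComplex ℝ E) (K₁ : Set (Finset E)) : Set (Finset E) :=
  {u | u ∈ K.faces ∧ u ∉ K₁ ∧ u ∉ Kept K K₁}

/-- Kept simplices form a down-closed family. [folklore] -/
theorem kept_down {τ t : Finset E} (hτ : τ ∈ Kept K K₁) (ht : t ⊆ τ) (hne : t.Nonempty) :
    t ∈ Kept K K₁ := by
  refine ⟨K.down_closed hτ.1 ht hne, fun ht₁ => ?_, fun s hs => ?_⟩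
  · have h := hτ.2.2 t ht₁
    rw [Finset.inter_eq_right.2 ht] at h
    exact hne.ne_empty h
  · have h := hτ.2.2 s hs
    rw [← Finset.subset_empty, ← h]
    exact Finset.inter_subset_inter ht (Finset.Subset.refl s)

/-- **The initial complex**: the refinement `R` of `K₁` together with the kept simplices.
[folklore] -/
theorem exists_initial (hK₁ : K₁ ⊆ K.faces) (hRfin : R.faces.Finite) (hKfin : K.faces.Finite)
    (hRa : ∀ r ∈ R.faces, ∃ s ∈ K₁, convexHull ℝ (r : Set E) ⊆ convexHull ℝ (s : Set E))
    (hRb : ∀ s ∈ K₁, ∀ y ∈ convexHull ℝ (s : Set E), ∃ r ∈ R.faces,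
      y ∈ convexHull ℝ (r : Set E) ∧ convexHull ℝ (r : Set E) ⊆ convexHull ℝ (s : Set E)) :
    ∃ C : Geometry.SimplicialComplex ℝ E, C.faces.Finite ∧ R.faces ⊆ C.faces ∧
      Kept K K₁ ⊆ C.faces ∧ ConeInv K K₁ C ∅ ∧
      ∀ t ∈ C.faces, t ∈ R.faces ∨ t ∈ Kept K K₁ := by
  -- hulls of kept simplices miss hulls of `R`
  have hdisj : ∀ τ ∈ Kept K K₁, ∀ r ∈ R.faces,
      convexHull ℝ (τ : Set E) ∩ convexHull ℝ (r : Set E) = ∅ := by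
    intro τ hτ r hr
    obtain ⟨s, hs, hrs⟩ := hRa r hr
    rw [Set.eq_empty_iff_forall_notMem]
    rintro x ⟨hxτ, hxr⟩
    have h := K.inter_subset_convexHull hτ.1 (hK₁ hs) ⟨hxτ, hrs hxr⟩
    rw [← Finset.coe_inter, hτ.2.2 s hs] at h
    simp at h
  refine ⟨{ faces := R.faces ∪ Kept K K₁
            isRelLowerSet_faces := ?_
            indep := ?_
            inter_subset_convexHull := ?_ }, hRfin.union (hKfin.subset fun τ hτ => hτ.1),
    Set.subset_union_left, Set.subset_union_right, ⟨?_, ?_⟩, fun t ht => ht⟩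
  · rintro t (ht | ht)
    · obtain ⟨hne, hlow⟩ := R.isRelLowerSet_faces ht
      exact ⟨hne, fun t' ht' hne' => Or.inl (hlow ht' hne')⟩
    · exact ⟨K.nonempty_of_mem_faces ht.1, fun t' ht' hne' => Or.inr (kept_down ht ht' hne')⟩
  · rintro t (ht | ht)
    · exact R.indep ht
    · exact K.indep ht.1
  · rintro t t' (ht | ht) (ht' | ht')
    · exact R.inter_subset_convexHull ht ht'
    · rw [Set.inter_comm, hdisj t' ht' t ht]; exact Set.empty_subset _
    · rw [hdisj t ht t' ht']; exact Set.empty_subset _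
    · exact K.inter_subset_convexHull ht.1 ht'.1
  · rintro r (hr | hr)
    · exact Or.inl (hRa r hr)
    · exact Or.inr (Or.inr hr)
  · rintro s (hs | hs | hs) y hy
    · obtain ⟨r, hr, hyr, hrs⟩ := hRb s hs y hy
      exact ⟨r, Or.inl hr, hyr, hrs⟩
    · exact hs.elim
    · exact ⟨s, Or.inr hs, hy, Subset.rfl⟩

/-- The vertex bookkeeping predicate: vertices of `C` are vertices of `R`, of kept simplices, or
centroids of simplices of `K`. (A `Prop`-valued structure: bookkeeping, not a named fact.)
[folklore] -/
structure VertexDesc (K R C : Geometry.SimplicialComplex ℝ E) (K₁ : Set (Finset E)) : Prop where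
  /-- the vertex description -/
  desc : ∀ t ∈ C.faces, ∀ v ∈ t, (∃ r ∈ R.faces, v ∈ r) ∨ (∃ τ ∈ Kept K K₁, v ∈ τ) ∨
    ∃ u ∈ K.faces, v = bary u

/-- **Iteration of the cone step** over all simplices to be coned with at most `k` vertices.
[folklore] -/
theorem exists_cone_iterate (hK₁ : K₁ ⊆ K.faces) (hdown : ∀ s ∈ K₁, ∀ t ⊆ s, t.Nonempty → t ∈ K₁)
    (hRfin : R.faces.Finite) (hKfin : K.faces.Finite)
    (hRa : ∀ r ∈ R.faces, ∃ s ∈ K₁, convexHull ℝ (r : Set E) ⊆ convexHull ℝ (s : Set E))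
    (hRb : ∀ s ∈ K₁, ∀ y ∈ convexHull ℝ (s : Set E), ∃ r ∈ R.faces,
      y ∈ convexHull ℝ (r : Set E) ∧ convexHull ℝ (r : Set E) ⊆ convexHull ℝ (s : Set E))
    (k : ℕ) :
    ∃ C : Geometry.SimplicialComplex ℝ E, C.faces.Finite ∧ R.faces ⊆ C.faces ∧
      Kept K K₁ ⊆ C.faces ∧ ConeInv K K₁ C {u | u ∈ ToCone K K₁ ∧ u.card ≤ k} ∧
      VertexDesc K R C K₁ := by
  classical
  induction k with
  | zero =>
    obtain ⟨C, hCfin, hRC, hKC, hinv, hdesc⟩ := exists_initial hK₁ hRfin hKfin hRa hRb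
    have h0 : {u | u ∈ ToCone K K₁ ∧ u.card ≤ 0} = (∅ : Set (Finset E)) := by
      rw [Set.eq_empty_iff_forall_notMem]
      rintro u ⟨hu, hcard⟩
      have := (K.nonempty_of_mem_faces hu.1).card_pos
      omega
    rw [h0]
    refine ⟨C, hCfin, hRC, hKC, hinv, ⟨fun t ht v hv => ?_⟩⟩
    rcases hdesc t ht with h | h
    · exact Or.inl ⟨t, h, hv⟩
    · exact Or.inr (Or.inl ⟨t, h, hv⟩)
  | succ k ih =>
    obtain ⟨C, hCfin, hRC, hKC, hinv, hdesc⟩ := ih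
    -- the simplices of cardinality `k + 1` to be coned, processed one at a time
    set Sk : Set (Finset E) := {u | u ∈ ToCone K K₁ ∧ u.card ≤ k} with hSk
    have hSkK : Sk ⊆ K.faces := fun u hu => hu.1.1
    set T₀ : Finset (Finset E) := hKfin.toFinset.filter fun u => u ∈ ToCone K K₁ ∧ u.card = k + 1
      with hT₀
    have key : ∀ T : Finset (Finset E), T ⊆ T₀ → ∃ C : Geometry.SimplicialComplex ℝ E,
        C.faces.Finite ∧ R.faces ⊆ C.faces ∧ Kept K K₁ ⊆ C.faces ∧
        ConeInv K K₁ C (Sk ∪ ↑T) ∧ VertexDesc K R C K₁ := by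
      intro T
      induction T using Finset.induction_on with
      | empty =>
        intro _
        refine ⟨C, hCfin, hRC, hKC, ?_, hdesc⟩
        simpa using hinv
      | @insert a T haT ihT =>
        intro hsub
        obtain ⟨C₁, hC₁fin, hRC₁, hKC₁, hinv₁, hdesc₁⟩ := ihT ((Finset.subset_insert a T).trans hsub)
        have ha : a ∈ ToCone K K₁ ∧ a.card = k + 1 := by
          have := Finset.mem_filter.1 (hsub (Finset.mem_insert_self a T))
          exact this.2
        have hDoneK : Sk ∪ ↑T ⊆ K.faces := by
          rintro u (hu | hu)
          · exact hSkK hu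
          · exact (Finset.mem_filter.1 (hsub (Finset.mem_insert_of_mem hu))).2.1.1
        have huD : a ∉ Sk ∪ ↑T := by
          intro hmem
          rcases hmem with hmem | haT'
          · have h1 : a.card ≤ k := hmem.2
            have h2 : a.card = k + 1 := ha.2
            omega
          · exact haT (Finset.mem_coe.1 haT')
        have hfaces : ∀ u' ∈ K.faces, u' ⊂ a → u' ∈ K₁ ∨ u' ∈ Sk ∪ ↑T ∨ u' ∈ Kept K K₁ := by
          intro u' hu' hss
          by_cases h₁ : u' ∈ K₁
          · exact Or.inl h₁
          by_cases hk : u' ∈ Kept K K₁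
          · exact Or.inr (Or.inr hk)
          refine Or.inr (Or.inl (Or.inl ⟨⟨hu', h₁, hk⟩, ?_⟩))
          have h1 := Finset.card_lt_card hss
          have h2 : a.card = k + 1 := ha.2
          omega
        have hcard : ∀ u'' ∈ Sk ∪ ↑T, u''.card ≤ a.card := by
          intro u'' hu''
          have h2 : a.card = k + 1 := ha.2
          rcases hu'' with hu'' | hu''
          · have h1 : u''.card ≤ k := hu''.2
            omega
          · have := (Finset.mem_filter.1 (hsub (Finset.mem_insert_of_mem (Finset.mem_coe.1 hu'')))).2.2
            omega
        obtain ⟨C₂, hC₂fin, hC₁C₂, hinv₂, hdesc₂⟩ := cone_step hK₁ hdown hDoneK hC₁fin hinv₁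
          ha.1.1 ha.1.2.1 huD ha.1.2.2 hfaces hcard
        refine ⟨C₂, hC₂fin, hRC₁.trans hC₁C₂, hKC₁.trans hC₁C₂, ?_, ⟨fun t ht v hv => ?_⟩⟩
        · have hset : insert a (Sk ∪ ↑T) = Sk ∪ ↑(insert a T) := by
            rw [Finset.coe_insert, Set.union_insert]
          rwa [hset] at hinv₂
        · rcases hdesc₂ t ht with ht₁ | ⟨r, hr, rfl⟩
          · exact hdesc₁.desc t ht₁ v hv
          · rcases Finset.mem_insert.1 hv with rfl | hvr
            · exact Or.inr (Or.inr ⟨a, ha.1.1, rfl⟩)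
            · rcases hr with hr | rfl
              · exact hdesc₁.desc r hr v hvr
              · simp at hvr
    obtain ⟨C', hC'fin, hRC', hKC', hinv', hdesc'⟩ := key T₀ (Finset.Subset.refl _)
    refine ⟨C', hC'fin, hRC', hKC', ?_, hdesc'⟩
    have hset : (Sk ∪ ↑T₀ : Set (Finset E)) = {u | u ∈ ToCone K K₁ ∧ u.card ≤ k + 1} := by
      ext u
      simp only [hSk, hT₀, Set.mem_union, Set.mem_setOf_eq, Finset.coe_filter, Set.Finite.mem_toFinset]
      constructor
      · rintro (⟨hu, hc⟩ | ⟨-, hu, hc⟩)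
        · exact ⟨hu, by omega⟩
        · exact ⟨hu, by omega⟩
      · rintro ⟨hu, hc⟩
        rcases Nat.lt_or_ge u.card (k + 1) with h | h
        · exact Or.inl ⟨hu, by omega⟩
        · exact Or.inr ⟨hu.1, hu, by omega⟩
    rwa [hset] at hinv'

/-- **The standard extension of a subdivision** (Munkres (1966), 7.11–7.12). Let `K` be a finite
simplicial complex, `K₁` a subcomplex and `R` a finite complex subdividing `K₁` simplexwise
(every simplex of `R` lies in a closed simplex of `K₁`, and every closed simplex of `K₁` is
covered by closed simplices of `R` inside it). Then there is a finite complex `K'` containing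
`R` and every simplex of `K` outside the closed star of `K₁`, refining `K` simplexwise, whose
simplices lie in closed simplices of `K₁` or in closed simplices of `K` not in `K₁`, and whose
vertices are vertices of `R`, of kept simplices, or centroids of simplices of `K`.
[cite: Munkres1966, Lemma 7.11] -/
theorem exists_standardExtension (hKfin : K.faces.Finite) (hK₁ : K₁ ⊆ K.faces)
    (hdown : ∀ s ∈ K₁, ∀ t ⊆ s, t.Nonempty → t ∈ K₁) (hRfin : R.faces.Finite)
    (hRa : ∀ r ∈ R.faces, ∃ s ∈ K₁, convexHull ℝ (r : Set E) ⊆ convexHull ℝ (s : Set E))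
    (hRb : ∀ s ∈ K₁, ∀ y ∈ convexHull ℝ (s : Set E), ∃ r ∈ R.faces,
      y ∈ convexHull ℝ (r : Set E) ∧ convexHull ℝ (r : Set E) ⊆ convexHull ℝ (s : Set E)) :
    ∃ K' : Geometry.SimplicialComplex ℝ E, K'.faces.Finite ∧ R.faces ⊆ K'.faces ∧
      Kept K K₁ ⊆ K'.faces ∧
      (∀ r ∈ K'.faces, (∃ s ∈ K₁, convexHull ℝ (r : Set E) ⊆ convexHull ℝ (s : Set E)) ∨
        ∃ u ∈ K.faces, u ∉ K₁ ∧ convexHull ℝ (r : Set E) ⊆ convexHull ℝ (u : Set E)) ∧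
      (∀ s ∈ K.faces, ∀ y ∈ convexHull ℝ (s : Set E), ∃ r ∈ K'.faces,
        y ∈ convexHull ℝ (r : Set E) ∧ convexHull ℝ (r : Set E) ⊆ convexHull ℝ (s : Set E)) ∧
      VertexDesc K R K' K₁ := by
  -- take `k` = the maximal cardinality of a simplex of `K`
  obtain ⟨k, hk⟩ : ∃ k : ℕ, ∀ u ∈ K.faces, u.card ≤ k := by
    refine ⟨hKfin.toFinset.sup Finset.card, fun u hu => ?_⟩
    exact Finset.le_sup (f := Finset.card) (hKfin.mem_toFinset.2 hu)
  obtain ⟨C, hCfin, hRC, hKC, hinv, hdesc⟩ := exists_cone_iterate hK₁ hdown hRfin hKfin hRa hRb k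
  have hall : {u | u ∈ ToCone K K₁ ∧ u.card ≤ k} = ToCone K K₁ :=
    Set.ext fun u => ⟨fun h => h.1, fun h => ⟨h, hk u h.1⟩⟩
  rw [hall] at hinv
  refine ⟨C, hCfin, hRC, hKC, fun r hr => ?_, fun s hs y hy => ?_, hdesc⟩
  · rcases hinv.refines r hr with h | ⟨u, hu, h⟩ | h
    · exact Or.inl h
    · exact Or.inr ⟨u, hu.1, hu.2.1, h⟩
    · exact Or.inr ⟨r, h.1, h.2.1, Subset.rfl⟩
  · by_cases h₁ : s ∈ K₁
    · exact hinv.covers s (Or.inl h₁) y hy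
    by_cases hk' : s ∈ Kept K K₁
    · exact hinv.covers s (Or.inr (Or.inr hk')) y hy
    · exact hinv.covers s (Or.inr (Or.inl ⟨hs, h₁, hk'⟩)) y hy

end Extension

end Literature.Analysis.Convexity
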